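import Summits.QuantumFields.YangMills.Theorems.UnitScaleTiltProp7LandauCombDict
import Literature.MathematicalPhysics.QuantumFieldTheory.Balaban1983to89.B9Eq321LandauMultiplierIffZdPer
import HarnessLib

/-!
# Route `UnitScaleTilt`, crux K1 «MinimiserStabilityRegPr» (stmt-QuantumFields-19200) — ARCHITECTURE (A′) «HCOW-VIA-Σ», EX ruling (27) (α), ★p1 g17 WORD 21 (c) «w1: QCOMB-L2 GO» —
# DEFINITIONS FILE: **PRINT'S COMB SITE-AVERAGING `Q′_k(W)` OF THE GAUGE PARAMETERS READ ON THE MEMBER'S `L²` SPACE (`QprimeCombL2`) AND THE PROJECTOR SLOT OF RECORD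
# `Rc(W) := projR (Δ^η_W) (Q′_k(W))` (`RcombL2`)** — [Balaban1985BackgroundPropagators] (3.17)–(3.19), (3.20)–(3.21) LITERALLY, at the T³ objects

Cell `ym3-torus` ∕ width seat `ym-ust-19200-w1` (gen 14).  Two `def`s (review lane) + their unfoldings and the kernel∕projector bookkeeping; `--supports stmt-QuantumFields-19200 --as helper`,
count-neutral.  YM₃ on T³ is a ladder rung (R3), not d = 4, not infinite volume, not the Clay problem; nothing here claims the stub, the crux, `hcoW`∕`hcoS`, [B9] Thm 3.11 or the gap.

THE PRINT.  [Balaban1985BackgroundPropagators] p. 393: «(Q′(V)λ)(y) = Σ_{x∈B(y)} L^{−d}R(V(Γ_{y,x}))λ(x), (Q′_j(U)λ)(y) = (Q′(Ū^{j−1})·…·Q′(Ū)Q′(U)λ)(y) = Σ_{x∈B^j(y)} L^{−jd}R(U(Γ^{(j)}_{y,x}))λ(x),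
y ∈ T^{(j)}_{L^jη} (3.19)»; p. 394: «R = R(U) is an orthogonal projection in the Hilbert space L²(Ω₀, 𝔤) onto the subspace ℛ = Δ^η_U N(Q′), N(Q′) = {λ : Q′λ = 0} (3.21)»;
[Balaban1985RegularSpaces] p. 77 «we admit the case when some domains Ω_j are equal to T_η», (1.38) p. 82 «R(U₀)D^{η*}_{U₀}A = 0».

WHY (WORD 21 (c)–(d)).  ✓`Prop7LandauCombDict.projR_covLapSite_eq_zero_of_isLandauPrint` feeds the (LANDAU-S) slot equation of ★p1's Σ-door for ANY `ℂ`-linear `Q′` with `ker Q′ ⊆ N(Q′_k(W))`;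
the namer fixes the PROJECTOR SLOT OF RECORD as `Rc W := projR (covLapSite F n K c₀ W) (Q′combL2 F n K c₀ W)` with the PRINT-LITERAL comb site averaging, and px6 g5's comb letters file
(`QL2c`, `Qkc`, `laplaceAc := laplaceALatticeK η⁻¹ (adBg W) (adBgInv W) (Δx W) (Rc W) (Qkc W) a`) imports it.  This file is that object: `Q′_k(W)` of (3.19) — the tree's `ℤ³`-lane letter
`QprimeIter (zdBlocking 3 L) (bgT L W♯) k` (the SAME letter inside `Prop7SPrint.IsLandauPrint` ∕ `RestrictedPrint`, transporters `W̄ʲ(Γ)` = `bgT`, based pullback `W♯` at `x₀ = basePt F n K`)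
— precomposed with brick L0a's readback `toL2S⁻¹` and read on the coarse torus `T^{(k)}` (`Site (F.P K) (K − n)`, representative `tlift`); plus `Rc`.

CONTENTS (ns `…Theorems.Prop7QprimeCombL2`):
* §1 `QprimeCombL2 F n K c₀ W : SiteL2K ℂ 3 (periodsT3 F K) c₀ W₂ →ₗ[ℂ] (Site (F.P K) (K − n) → M₂(ℂ))` (def), `QprimeCombL2_apply` (`rfl`), `sitesPerDir_zero_eq` (`N₀ = Lᵏ·N_k`),
  `isPeriodic_QprimeIter_pullS` (the comb average of a torus gauge parameter is `N_k`-periodic on `ℤ³`, lit `isPeriodic_QprimeIter`), `QprimeIter_pullS_eq_apply_tcls`,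
  ★`QprimeCombL2_eq_zero_iff` (`Q′ v = 0 ↔ ∀ y : ℤ³, Q′_k(W) v♯ y = 0` — the kernel IS print's `N(Q′_k(W))` in `IsLandauPrint`'s letters), `hQ_QprimeCombL2` (the `hQ'` of ✓`Prop7LandauCombDict` DISCHARGED);
* §2 `RcombL2 F n K c₀ W := projR (covLapSite F n K c₀ W) (QprimeCombL2 F n K c₀ W)` (def; «PROJECTOR SLOT OF RECORD» WORD 21 (c)), `RcombL2_eq_projR` (`rfl`), `RcombL2_eq_RLatticeK`
  (lit-balaban's letter, by ✓`covLapSite_eq`), `RcombL2_isSymmetric`, `RcombL2_idem` (T1-slots' «symmetric idempotent», lit `projR_isSymmetric`∕`projR_projR`),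
  ★★★`RcombL2_DstarL2_eq_zero_of_isLandauPrint` ∕ `RcombL2_DstarL2_smul_eq_zero_of_isLandau138` (+ `_of_regPr` twins) — THE (LANDAU-S) SLOT EQUATION AT THE SLOT OF RECORD:
  `IsLandauPrint F n K W X` (resp. the raw prefix letter `IsLandau138 … W♯ A♯`) ⟹ `Rc W (DstarL2 W (toL2 X)) = 0` (resp. `… (toL2 (c • A)) = 0`), the transporters' unitarity taken
  from `RegPr` in the `_of_regPr` forms.
HONEST SCOPE.  Definitions + bookkeeping; no estimate; «Q′ onto» ((3.19), lit `B9Eq319Onto`) is NOT in this file (next append); [B9] Thm 3.11∕3.3 NOT proved; nothing of (A′)∕E′∕EX∕the crux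
claimed.  No `instance`, no `notation`.

References: T. Bałaban, CMP **99** (1985) 389–434 [Balaban1985BackgroundPropagators] ((3.17)–(3.19) p.393, (3.20)–(3.23) p.394); CMP **99** (1985) 75–102 [Balaban1985RegularSpaces]
(p.77, (1.29) p.81, (1.38) p.82); CMP **102** (1985) 277–309 [Balaban1985Variational] ((21) p.281); CMP **98** (1985) 17–51 [Balaban1985Averaging] ((78)–(80) p.30, Prop. 2 p.26).
-/

set_option autoImplicit false

noncomputable section

open scoped Matrix.Norms.L2Operator InnerProductSpace BigOperators

namespace Summit.QuantumFields.YangMills.Theorems.Prop7QprimeCombL2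

open Literature.MathematicalPhysics.QuantumFieldTheory.Balaban1983to89
open Literature.MathematicalPhysics.QuantumFieldTheory.Balaban1983to89.T3ContinuumYM3Torus
open Literature.MathematicalPhysics.QuantumFieldTheory.Balaban1983to89.T3PrintedRegularMinimiser (RegPr)
open B7Prop1Explicit renaming Site → LSite
open B7Prop2Explicit (C0 c2' unitaryUnits)
open B7Eq78Linearization (QprimeIter zdBlocking QprimeIter_add QprimeIter_smul)
open B8Eq119TwistedAxial (bgT)
open B8Eq138LandauZd (IsLandau138)
open B8Thm4TorusAt (torusLam)
open B10Eq27TorusAxialLog (transl pull)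
open T4TermwiseTorus (IsPeriodic tcls tlift tcls_tlift tcls_eq_tcls_iff)
open T3SectALandauChart (bgUnits eta)
open B11Eq103H1Complex (SiteL2K projR RLatticeK projR_isSymmetric projR_projR)
open Summit.QuantumFields.YangMills.Theorems.Prop7SectET3Transport (periodsT3)
open Summit.QuantumFields.YangMills.Theorems.Prop7SectET3HilbertLetters (W₂ adBg adBgInv toL2 toL2S DstarL2 covLapSite covLapSite_eq)
open Summit.QuantumFields.YangMills.Theorems.Prop7SPrint (basePt IsLandauPrint)
open Summit.QuantumFields.YangMills.Theorems.Prop7LandauCombDict (isPeriodic_pull isPeriodic_comp_transl projR_covLapSite_eq_zero_of_isLandauPrint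
  projR_covLapSite_smul_eq_zero_of_isLandau138 bgT_pull_mem_unitaryUnits_of_regPr)

/-! ## §1 `Q′_k(W)` on the member's `L²` space of gauge parameters -/

section Qprime

variable (F : T3Family) (n K : ℕ) (c₀ : ℝ)

/-- **PRINT'S COMB SITE AVERAGING `Q′_k(W)` OF THE GAUGE PARAMETERS, READ ON THE MEMBER'S WEIGHTED `L²` SPACE** ([Balaban1985BackgroundPropagators] (3.17)–(3.19), `k = K − n` levels,
transporters `W̄ʲ(Γ_{y,x})`): brick L0a's gauge parameter `v` is read back on the route carrier (`toL2S⁻¹`), pulled back to `ℤ³` at the base point `x₀ = basePt F n K` (the letter of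
`Prop7SPrint.IsLandauPrint` ∕ `RestrictedPrint`), averaged by the tree's `QprimeIter (zdBlocking 3 L) (bgT L W♯) k`, and read on the coarse torus `T^{(k)}` through the representative
`tlift y ∈ [0, N_k)³` of `y : Site (F.P K) (K − n)` (the average is `N_k`-periodic: `isPeriodic_QprimeIter_pullS`).  `ℂ`-linear by `QprimeIter_add`∕`QprimeIter_smul`.
[cite: Balaban1985BackgroundPropagators, (3.17)-(3.19) p.393; Balaban1985RegularSpaces, (1.29) p.81, p.77] -/
def QprimeCombL2 (W : GaugeField (F.P K) 0 (Matrix.specialUnitaryGroup (Fin 2) ℂ)) :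
    SiteL2K ℂ 3 (periodsT3 F K) c₀ W₂ →ₗ[ℂ] (Site (F.P K) (K - n) → Matrix (Fin 2) (Fin 2) ℂ) where
  toFun v y := QprimeIter (zdBlocking (F.P K).d (F.P K).L) (bgT (F.P K).L (pull (bgUnits F K W) (basePt F n K))) (K - n)
    (fun z => (toL2S F K c₀).symm v (transl (basePt F n K) z)) (tlift y)
  map_add' v w := by
    funext y
    have h := congrFun (QprimeIter_add (G := zdBlocking (F.P K).d (F.P K).L) (T := bgT (F.P K).L (pull (bgUnits F K W) (basePt F n K)))
      (fun z => (toL2S F K c₀).symm v (transl (basePt F n K) z)) (fun z => (toL2S F K c₀).symm w (transl (basePt F n K) z)) (K - n)) (tlift y)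
    simpa only [map_add, Pi.add_apply] using h
  map_smul' c v := by
    funext y
    have h := congrFun (QprimeIter_smul (G := zdBlocking (F.P K).d (F.P K).L) (T := bgT (F.P K).L (pull (bgUnits F K W) (basePt F n K))) c
      (fun z => (toL2S F K c₀).symm v (transl (basePt F n K) z)) (K - n)) (tlift y)
    simpa only [map_smul, Pi.smul_apply, RingHom.id_apply] using h

variable {F n K c₀}

/-- `QprimeCombL2` unfolded: `(Q′ v)(y) = (Q′_k(W) v♯)(tlift y)`. [cite: Balaban1985BackgroundPropagators, (3.19) p.393] -/
theorem QprimeCombL2_apply (W : GaugeField (F.P K) 0 (Matrix.specialUnitaryGroup (Fin 2) ℂ)) (v : SiteL2K ℂ 3 (periodsT3 F K) c₀ W₂) (y : Site (F.P K) (K - n)) :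
    QprimeCombL2 F n K c₀ W v y = QprimeIter (zdBlocking (F.P K).d (F.P K).L) (bgT (F.P K).L (pull (bgUnits F K W) (basePt F n K))) (K - n)
      (fun z => (toL2S F K c₀).symm v (transl (basePt F n K) z)) (tlift y) := rfl

/-- The finest torus has `N₀ = Lᵏ·N_k` sites per direction, `N_k` those of the coarse torus `T^{(k)}`, `k = K − n` ([B8] p. 77: every block lattice divides `T_η`).
[cite: Balaban1985RegularSpaces, p.77] -/
theorem sitesPerDir_zero_eq (F : T3Family) (n K : ℕ) (hnK : n ≤ K) : (F.P K).sitesPerDir 0 = (F.P K).L ^ (K - n) * (F.P K).sitesPerDir (K - n) := by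
  show 2 * F.L ^ (F.m + K - 0) = F.L ^ (K - n) * (2 * F.L ^ (F.m + K - (K - n)))
  have h : F.m + K - 0 = (K - n) + (F.m + K - (K - n)) := by omega
  rw [h, pow_add]; ring

/-- **THE COMB AVERAGE OF A TORUS GAUGE PARAMETER IS `N_k`-PERIODIC ON `ℤ³`** (translation covariance of (3.19), lit `isPeriodic_QprimeIter`; the pullbacks are `N₀`-periodic).
[cite: Balaban1985BackgroundPropagators, (3.19) p.393; Balaban1985RegularSpaces, p.77] -/
theorem isPeriodic_QprimeIter_pullS (hnK : n ≤ K) (W : GaugeField (F.P K) 0 (Matrix.specialUnitaryGroup (Fin 2) ℂ)) (l : Site (F.P K) 0 → Matrix (Fin 2) (Fin 2) ℂ) :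
    IsPeriodic ((F.P K).sitesPerDir (K - n)) (QprimeIter (zdBlocking (F.P K).d (F.P K).L) (bgT (F.P K).L (pull (bgUnits F K W) (basePt F n K))) (K - n)
      (fun z => l (transl (basePt F n K) z))) := by
  letI : CStarAlgebra (Matrix (Fin 2) (Fin 2) ℂ) := B10Eq29TubeLine.cstarAlgebraMatrix 2
  exact B9Eq321LandauMultiplierIffZdPer.isPeriodic_QprimeIter (isPeriodic_pull (bgUnits F K W) (basePt F n K)) (isPeriodic_comp_transl (basePt F n K) l)
    (sitesPerDir_zero_eq F n K hnK)

/-- Hence the comb average at ANY `y ∈ ℤ³` is its value at the cell representative `tlift (tcls y)`: `(Q′_k v♯)(y) = (QprimeCombL2 v)(tcls y)`.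
[cite: Balaban1985BackgroundPropagators, (3.19) p.393; Balaban1985RegularSpaces, p.77] -/
theorem QprimeIter_pullS_eq_apply_tcls (hnK : n ≤ K) (W : GaugeField (F.P K) 0 (Matrix.specialUnitaryGroup (Fin 2) ℂ)) (v : SiteL2K ℂ 3 (periodsT3 F K) c₀ W₂)
    (y : LSite (F.P K).d) :
    QprimeIter (zdBlocking (F.P K).d (F.P K).L) (bgT (F.P K).L (pull (bgUnits F K W) (basePt F n K))) (K - n)
        (fun z => (toL2S F K c₀).symm v (transl (basePt F n K) z)) y
      = QprimeCombL2 F n K c₀ W v (tcls ((F.P K).sitesPerDir (K - n)) y) := by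
  rw [QprimeCombL2_apply]
  -- `y = tlift (tcls y) + N_k • m`
  obtain ⟨m, hm⟩ := (tcls_eq_tcls_iff (T := (F.P K).sitesPerDir (K - n))).1
    (tcls_tlift (T := (F.P K).sitesPerDir (K - n)) (tcls ((F.P K).sitesPerDir (K - n)) y))
  conv_lhs => rw [hm]
  exact isPeriodic_QprimeIter_pullS hnK W _ _ m

/-- ★ **THE KERNEL OF `QprimeCombL2` IS PRINT'S RESIDUAL ALGEBRA `N(Q′_k(W))`, IN `IsLandauPrint`'s OWN LETTERS**: `Q′ v = 0 ↔ ∀ y : ℤ³, (Q′_k(W) v♯)(y) = 0`.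
[cite: Balaban1985BackgroundPropagators, (3.21) p.394 («N(Q′) = {λ : Q′λ = 0}»), (3.19) p.393] -/
theorem QprimeCombL2_eq_zero_iff (hnK : n ≤ K) (W : GaugeField (F.P K) 0 (Matrix.specialUnitaryGroup (Fin 2) ℂ)) (v : SiteL2K ℂ 3 (periodsT3 F K) c₀ W₂) :
    QprimeCombL2 F n K c₀ W v = 0 ↔
      ∀ y : LSite (F.P K).d, QprimeIter (zdBlocking (F.P K).d (F.P K).L) (bgT (F.P K).L (pull (bgUnits F K W) (basePt F n K))) (K - n)
        (fun z => (toL2S F K c₀).symm v (transl (basePt F n K) z)) y = 0 := by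
  constructor
  · intro h y
    rw [QprimeIter_pullS_eq_apply_tcls hnK, h]
    rfl
  · intro h
    funext y
    rw [QprimeCombL2_apply, h]
    rfl

/-- **THE HYPOTHESIS `hQ'` OF ✓`Prop7LandauCombDict` DISCHARGED FOR `QprimeCombL2`** (`ker Q′ ⊆ N(Q′_k(W))`, here an `Iff`). [cite: Balaban1985BackgroundPropagators, (3.21) p.394] -/
theorem hQ_QprimeCombL2 (hnK : n ≤ K) (W : GaugeField (F.P K) 0 (Matrix.specialUnitaryGroup (Fin 2) ℂ)) :
    ∀ v : SiteL2K ℂ 3 (periodsT3 F K) c₀ W₂, QprimeCombL2 F n K c₀ W v = 0 →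
      ∀ y : LSite (F.P K).d, QprimeIter (zdBlocking (F.P K).d (F.P K).L) (bgT (F.P K).L (pull (bgUnits F K W) (basePt F n K))) (K - n)
        (fun z => (toL2S F K c₀).symm v (transl (basePt F n K) z)) y = 0 :=
  fun v hv => (QprimeCombL2_eq_zero_iff hnK W v).1 hv

end Qprime

/-! ## §2 The projector slot of record `Rc(W) = projR (Δ^η_W) (Q′_k(W))` and its (LANDAU-S) equation -/

section Projector

variable (F : T3Family) (n K : ℕ) (c₀ : ℝ) [Fact (0 < c₀)]

/-- **THE PROJECTOR SLOT OF RECORD `Rc(W) := R(W)` OF (3.21) AT THE COMB PAIR** (★p1 g17 WORD 21 (c)): the orthogonal projection, in brick L0a's weighted `L²` space of gauge parameters,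
onto `ℛ = Δ^η_W N(Q′_k(W))` — lit-balaban's CONSTRUCTED `projR` at the member's covariant Laplacian `covLapSite W = D*_W D_W` and the print-literal comb averaging `QprimeCombL2 W`.
[cite: Balaban1985BackgroundPropagators, (3.20)-(3.23) p.394] -/
def RcombL2 (W : GaugeField (F.P K) 0 (Matrix.specialUnitaryGroup (Fin 2) ℂ)) :
    SiteL2K ℂ 3 (periodsT3 F K) c₀ W₂ →ₗ[ℂ] SiteL2K ℂ 3 (periodsT3 F K) c₀ W₂ :=
  projR (covLapSite F n K c₀ W) (QprimeCombL2 F n K c₀ W)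

variable {F n K c₀}

/-- `RcombL2` unfolded. [cite: Balaban1985BackgroundPropagators, (3.21) p.394] -/
theorem RcombL2_eq_projR (W : GaugeField (F.P K) 0 (Matrix.specialUnitaryGroup (Fin 2) ℂ)) :
    RcombL2 F n K c₀ W = projR (covLapSite F n K c₀ W) (QprimeCombL2 F n K c₀ W) := rfl

/-- `RcombL2` in lit-balaban's `RLatticeK` letter (the shape of ✓`Prop7SectET3GaugeProjector.RS`, with `Q′ := QprimeCombL2 W` in place of `QDS`).
[cite: Balaban1985BackgroundPropagators, (3.21)-(3.23) p.394] -/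
theorem RcombL2_eq_RLatticeK (W : GaugeField (F.P K) 0 (Matrix.specialUnitaryGroup (Fin 2) ℂ)) :
    RcombL2 F n K c₀ W = RLatticeK (((eta F n K : ℝ) : ℂ)⁻¹) (adBg F K W) (adBgInv F K W) (QprimeCombL2 F n K c₀ W) := by
  rw [RcombL2, RLatticeK, covLapSite_eq]

/-- `Rc(W)` is symmetric («orthogonal projection», (3.20); T1-slots' hypothesis). [cite: Balaban1985BackgroundPropagators, (3.20)-(3.21) p.394] -/
theorem RcombL2_isSymmetric (W : GaugeField (F.P K) 0 (Matrix.specialUnitaryGroup (Fin 2) ℂ)) : (RcombL2 F n K c₀ W).IsSymmetric :=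
  projR_isSymmetric _ _

/-- `Rc(W)² = Rc(W)` (T1-slots' hypothesis). [cite: Balaban1985BackgroundPropagators, (3.21) p.394] -/
theorem RcombL2_idem (W : GaugeField (F.P K) 0 (Matrix.specialUnitaryGroup (Fin 2) ℂ)) (v : SiteL2K ℂ 3 (periodsT3 F K) c₀ W₂) :
    RcombL2 F n K c₀ W (RcombL2 F n K c₀ W v) = RcombL2 F n K c₀ W v :=
  projR_projR _ _ v

/-- ★★★ **THE (LANDAU-S) SLOT EQUATION AT THE SLOT OF RECORD, FROM THE PREDICATE**: `IsLandauPrint F n K W X` and unitary tower transporters (`j ≤ k`) ⟹ `Rc(W)(D*_W X̃) = 0`.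
[cite: Balaban1985Variational, (21) p.281; Balaban1985RegularSpaces, (1.38) p.82; Balaban1985BackgroundPropagators, (3.20)-(3.21) p.394] -/
theorem RcombL2_DstarL2_eq_zero_of_isLandauPrint (hnK : n ≤ K) (W : GaugeField (F.P K) 0 (Matrix.specialUnitaryGroup (Fin 2) ℂ))
    (X : PBond (F.P K) 0 → Matrix (Fin 2) (Fin 2) ℂ) (hLan : IsLandauPrint F n K W X)
    (hT : ∀ j, j ≤ K - n → ∀ z y : LSite (F.P K).d,
      bgT (F.P K).L (pull (bgUnits F K W) (basePt F n K)) j z y ∈ unitaryUnits (Matrix (Fin 2) (Fin 2) ℂ)) :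
    RcombL2 F n K c₀ W (DstarL2 F n K c₀ W (toL2 F K c₀ X)) = 0 :=
  projR_covLapSite_eq_zero_of_isLandauPrint (c₀ := c₀) W X hLan hT (QprimeCombL2 F n K c₀ W) (hQ_QprimeCombL2 hnK W)

/-- ★★★ **THE SAME FROM THE RAW PREFIX LETTER** `IsLandau138 … W♯ A♯` of the `hcoW`∕`hcoS` binder, for the scaled form `c • A` (door letters `c := eta F n K`).
[cite: Balaban1985RegularSpaces, (1.38) p.82; Balaban1985BackgroundPropagators, (3.20)-(3.21) p.394] -/
theorem RcombL2_DstarL2_smul_eq_zero_of_isLandau138 (hnK : n ≤ K) (W : GaugeField (F.P K) 0 (Matrix.specialUnitaryGroup (Fin 2) ℂ))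
    (A : PBond (F.P K) 0 → Matrix (Fin 2) (Fin 2) ℂ)
    (h138 : IsLandau138 (F.P K).L (K - n) (eta F n K) (Set.univ : Set (LSite (F.P K).d)) (torusLam (K - n))
      (pull (bgUnits F K W) (basePt F n K)) (pull A (basePt F n K)))
    (hT : ∀ j, j ≤ K - n → ∀ z y : LSite (F.P K).d,
      bgT (F.P K).L (pull (bgUnits F K W) (basePt F n K)) j z y ∈ unitaryUnits (Matrix (Fin 2) (Fin 2) ℂ)) (c : ℝ) :
    RcombL2 F n K c₀ W (DstarL2 F n K c₀ W (toL2 F K c₀ (c • A))) = 0 :=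
  projR_covLapSite_smul_eq_zero_of_isLandau138 (c₀ := c₀) W A h138 hT (QprimeCombL2 F n K c₀ W) (hQ_QprimeCombL2 hnK W) c

/-- ★★★ **MEMBER READING, FROM THE PREDICATE**: `RegPr F n K a W` (L-only windows `C₀(3)·2a ≤ ⅓`, `4a ≤ c₂′`) and `IsLandauPrint F n K W X` ⟹ `Rc(W)(D*_W X̃) = 0` — the (LANDAU-S) conjunct of
★p1's Σ-door at `Rr := RcombL2 F n K (c₀ F.L)`, with NOTHING displayed. [cite: Balaban1985Variational, (21) p.281; Balaban1985RegularSpaces, (1.38) p.82, (1.7) p.77; Balaban1985BackgroundPropagators, (3.21) p.394; Balaban1985Averaging, Prop. 2 p.26] -/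
theorem RcombL2_DstarL2_eq_zero_of_isLandauPrint_of_regPr (hnK : n ≤ K) {a : ℝ} (ha : 0 < a) (hα3 : C0 (F.P K).d * (2 * a) ≤ 1 / 3)
    (hα4 : 4 * a ≤ c2' (F.P K).d (F.P K).L) {W : GaugeField (F.P K) 0 (Matrix.specialUnitaryGroup (Fin 2) ℂ)} (hreg : RegPr F n K a W)
    {X : PBond (F.P K) 0 → Matrix (Fin 2) (Fin 2) ℂ} (hLan : IsLandauPrint F n K W X) :
    RcombL2 F n K c₀ W (DstarL2 F n K c₀ W (toL2 F K c₀ X)) = 0 :=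
  RcombL2_DstarL2_eq_zero_of_isLandauPrint hnK W X hLan (bgT_pull_mem_unitaryUnits_of_regPr F ha hα3 hα4 hreg)

/-- ★★★ **MEMBER READING, FROM THE RAW PREFIX LETTER**: `RegPr F n K a W` and `IsLandau138 … W♯ A♯` ⟹ `Rc(W)(D*_W (c•A)~) = 0` (door letters `toL2 F K (c₀ F.L) (eta F n K • A)`).
[cite: Balaban1985RegularSpaces, (1.38) p.82, (1.7) p.77; Balaban1985BackgroundPropagators, (3.21) p.394; Balaban1985Averaging, Prop. 2 p.26] -/
theorem RcombL2_DstarL2_smul_eq_zero_of_isLandau138_of_regPr (hnK : n ≤ K) {a : ℝ} (ha : 0 < a) (hα3 : C0 (F.P K).d * (2 * a) ≤ 1 / 3)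
    (hα4 : 4 * a ≤ c2' (F.P K).d (F.P K).L) {W : GaugeField (F.P K) 0 (Matrix.specialUnitaryGroup (Fin 2) ℂ)} (hreg : RegPr F n K a W)
    (A : PBond (F.P K) 0 → Matrix (Fin 2) (Fin 2) ℂ)
    (h138 : IsLandau138 (F.P K).L (K - n) (eta F n K) (Set.univ : Set (LSite (F.P K).d)) (torusLam (K - n))
      (pull (bgUnits F K W) (basePt F n K)) (pull A (basePt F n K))) (c : ℝ) :
    RcombL2 F n K c₀ W (DstarL2 F n K c₀ W (toL2 F K c₀ (c • A))) = 0 :=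
  RcombL2_DstarL2_smul_eq_zero_of_isLandau138 hnK W A h138 (bgT_pull_mem_unitaryUnits_of_regPr F ha hα3 hα4 hreg) c

end Projector

end Summit.QuantumFields.YangMills.Theorems.Prop7QprimeCombL2

end
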